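import Summits.QuantumFields.YangMills.Theorems.BalabanUVNodesN22AtRateRecord12
import Summits.QuantumFields.YangMills.Theorems.BalabanUVNodesN22AtRateRecord12Fixed
import Literature.MathematicalPhysics.QuantumFieldTheory.Balaban1983to89.Node00.RateRecordW1Reading

/-!
# BalabanUVNodes ∕ node N22 = NE9 ∧ fading memory AT THE NAMED W1 READING OF THE STAGE-12 RATE-RECORD HOME —
# `𝔯_W1 := RateReading₁₂.ofAssignment (W1.assignment₁₂ 𝔇) ne1` (node00-def-W1 g2, `Node00/RateRecordW1Reading.lean`, p465810): WHAT `S_N22 (RRec₁₂ 𝔯_W1)` SAYS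
# (the history-Lipschitz inequality for `Re E^{(j)}(X; ·; embA U)` of 𝔇's towers, per run length, on `]0, θ.γ]`, with the analytic block's moduli), ROAD 3 at the
# named reading (ONE application of `s_N22_rRec₁₂_of_oscAnalytic`: (P) free, letter equations `rfl`), the slot-free road (NE9 in any fading table), and the kernel
# honesty rider «vanishing towers close the stub»

Track A of `YM-PLAN.md` (cell `pub-ymgap`, HUMAN RULING D-0062), R134 seat `pub-ymgap-dag-n22-e` (s2), gen 2, module 4 — the lineage's g0 HANDOFF trigger (t2)
«a NAMED W1 reading `𝔯_W1` lands ⇒ `S_N22 (RRec 𝔯_W1)` one application» AT THE NAMED READING, Stage 12.  THEOREMS ONLY; imports this seat's modules 2 ∕ 3 at ₁₂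
(`…N22AtRateRecord12`: `s_N22_rRec₁₂_iff`, `s_N22_rRec₁₂_of_oscAnalytic`; `…N22AtRateRecord12Fixed`: `s_N22_rRec₁₂_of_ne9_fading`, `n22At_u3OfRecord₁₂_of_ne9_le`) and
W1 g2's `Node00/RateRecordW1Reading` (`W1.AssignmentInputs₁₂`, `W1.assignment₁₂`, `W1.ReadingData.u3Objects`, `W1.LetterInputs.analytic`, the `rfl` faces
`assignment₁₂_u3 ∕ _ω ∕ _C₉`, `prefixDependenceOn_assignment₁₂_EA`).  COUNT-NEUTRAL; `--supports` K3′ `SpineGivenEndpointR12` (stmt-QuantumFields-19792).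
Restate-immune (no Theses import).

THE NAMED READING.  For W1's residual inputs `𝔇 : W1.AssignmentInputs₁₂ N` (per `(F, θ)`: the towers of one-step cluster data `(𝔇.w1 F θ).S k` of the run of `k` steps on
the `k`-th torus — the (2.14) TERMS, residual —, the level pairings, the letter inputs `li`; per `(F, θ, g₀, os)` N16's ∕ N15's single-scale objects) and ANY dressed-tower
assignment `ne1`, the reading is `𝔯_W1 𝔇 ne1 := RateReading₁₂.ofAssignment (W1.assignment₁₂ 𝔇) ne1` (spelled inline below; no `def`).  Its U3 objects at `(F, θ)` ARE
`(𝔇.w1 F θ).u3Objects θ.γ` (`rfl`), so N22's stub reads NEITHER `g₀, os` NOR `ne1 ∕ ne3 ∕ ne2`.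

WHAT IS KERNEL-CHECKED ([folklore] bookkeeping; 0 `def`, 0 `sorry`).
* §1 `s_N22_rRec₁₂_w1_iff` — `S_N22 (RRec₁₂ 𝔯_W1)` IS «`N22At (u3OfRecord₁₂ h.params ((𝔇.w1 F h.params).u3Objects h.params.γ) k)` at every Stage-12 datum key and run
  length» · `n22At_w1_iff_ne9` — under the analytic block's signs, `N22At` at the W1 bundle IS the history-Lipschitz inequality for `Re E^{(j)}(X; ·; embA U)` of the tower
  `(𝔇.w1 F θ).S k` on `]0, θ.γ]` with decay `li.κ` and moduli `C₉·ω^{j−i}` of `li.analytic θ.γ` (W1's `ne9_u3Objects_iff` through layer B's `n22At_u3OfRecord₁₂_iff`) ·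
  `s_N22_rRec₁₂_w1_iff_ne9` — the two together: WHAT THE STUB SAYS at the named reading, in print-like form.
* §2 ROAD 3 AT THE NAMED READING: `s_N22_rRec₁₂_w1_of_oscAnalytic` — (O) oscillation with `li.C₀` and (A) analyticity with sup letter `li.A·li.μ^{age−1}·e^{−κd}` on the
  closed `li.r`-discs, per admissible tuple with provisos and run length, plus the numeric signs of `li` ⟹ `S_N22 (RRec₁₂ 𝔯_W1)`; (P) is W1's THEOREM
  `prefixDependenceOn_assignment₁₂_EA`, the letter equations are `rfl` (`assignment₁₂_ω ∕ _C₉`).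
* §3 THE SLOT-FREE ROAD: `s_N22_rRec₁₂_w1_of_ne9_fading` — signs + NE9 of every level functional in ANY table fading below the block's `(C₉, ω)` ⟹ the stub.
* §4 HONESTY: `s_N22_rRec₁₂_w1_of_EA_zero` — if every level functional of `𝔇` VANISHES identically (W1's termless towers,
  `W1.exists_assignmentInputs₁₂_populated_functionals_zero`) and the blocks carry their signs, the stub HOLDS with nothing proved: a discharge of `S_N22 (RRec₁₂ 𝔯_W1)`
  NAMES its `𝔇` and owes the identification of `𝔇`'s towers with the construction's (2.14) terms (W1 §6's located point, now at node N22's stub).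

HONEST FRAMING.  Kernel bookkeeping by name; (O), (A), NE9 are DISPLAYED hypotheses on 𝔇's residual towers with no producer today (n22-c g2's strip induction
p462912 ∕ p463776 is the (A)-side supplier in progress); nothing of Bałaban's is asserted or instantiated — NE9 is NOT PRINTED for d = 4 («OBJECT-bound»; [Balaban1987RG1]
p. 263: C^∞ «(or analytic)» in the LAST coupling only) and NOT PROVED; `𝔇` is residual; no inhabitant of `IsDatumOfRecord₁₂C` claimed (K0′); N22 NOT discharged; counts
UNMOVED (typed 28∕28 · discharged 5∕27, A 5∕28); one finite four-torus programme at fixed `ε` — NOT ℝ⁴, NOT infinite volume, NOT OS, NOT a mass gap, NOT Clay.  No cite tags.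
-/

noncomputable section

namespace YMDAG.N22

open Set Metric
open scoped BigOperators
open Literature.MathematicalPhysics.QuantumFieldTheory.Balaban1983to89
open Literature.MathematicalPhysics.QuantumFieldTheory.Balaban1983to89.T4Continuum
open Literature.MathematicalPhysics.QuantumFieldTheory.Balaban1983to89.T4OutputRate
open Literature.MathematicalPhysics.QuantumFieldTheory.Balaban1983to89.Node00 (Stage12Params IsDatumOfRecord₁₂C U3Objects₁₁ U3Letters₁₁)
open Literature.MathematicalPhysics.QuantumFieldTheory.Balaban1983to89.Node00.Sect2 (domSys)
open Literature.MathematicalPhysics.QuantumFieldTheory.Balaban1983to89.Node00.W1 (AssignmentInputs₁₂ assignment₁₂ functionalC)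
open YMDAG.UVSplit

variable {N : ℕ} [NeZero N] (𝔇 : AssignmentInputs₁₂ N)
  (ne1 : (F : T4Family) → Stage12Params F N → (ℕ → ℝ) → List (ULoop F) → NE1pCarriers)

/-! ## §1 What `S_N22 (RRec₁₂ 𝔯_W1)` says -/

/-- The named reading's U3 objects at `(F, θ)` ARE W1's `(𝔇.w1 F θ).u3Objects θ.γ` — `g₀`, `os`, the provisos and `ne1` are NOT read (`rfl`). [folklore] -/
theorem rateReading₁₂_w1_u3 (F : T4Family) (θ : Stage12Params F N) (hP : θ.Provisos₁₂ F N) (g₀ : ℕ → ℝ) (os : List (ULoop F)) :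
    ((RateReading₁₂.ofAssignment (assignment₁₂ 𝔇) ne1).lit F θ hP g₀ os).u3 = (𝔇.w1 F θ).u3Objects θ.γ := rfl

/-- **`S_N22 (RRec₁₂ 𝔯_W1)` IS «`N22At` AT EVERY STAGE-12 DATUM KEY AND RUN LENGTH of W1's objects at the canonical parameter»** (`g₀`, `os`, `ne1` idle). [folklore] -/
theorem s_N22_rRec₁₂_w1_iff :
    S_N22 (RRec₁₂ (RateReading₁₂.ofAssignment (assignment₁₂ 𝔇) ne1)) ↔
      ∀ (F : T4Family) (D : Datum F N) (h : IsDatumOfRecord₁₂C F N D) (k : ℕ),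
        N22At (u3OfRecord₁₂ h.params ((𝔇.w1 F h.params).u3Objects h.params.γ) k) := by
  rw [s_N22_rRec₁₂_iff]
  exact ⟨fun H F D h k => H F D h (fun _ => 0) [] k, fun H F D h _ _ k => H F D h k⟩

/-- **UNDER THE ANALYTIC BLOCK's SIGNS, `N22At` AT THE W1 BUNDLE IS THE HISTORY-LIPSCHITZ INEQUALITY FOR `Re E^{(j)}(X; ·; embA U)` OF THE TOWER `(𝔇.w1 F θ).S k`**
on the `k`-th torus: for all histories `g, g′ ∈ ]0, θ.γ]^ℕ`, run-A backgrounds `U` and domains `(j, X)`,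
`|Re E(S k)(X; g; embA U) − Re E(S k)(X; g′; embA U)| ≤ e^{−κ·d_j(X)} · Σ_{i<j} C₉·ω^{j−i}·|g_i − g′_i|` with `κ = li.κ` and `C₉, ω` the analytic block's at radius
`θ.γ` (layer B's `n22At_u3OfRecord₁₂_iff` + W1's `ne9_u3Objects_iff`, both definitional). [folklore] -/
theorem n22At_w1_iff_ne9 {F : T4Family} (θ : Stage12Params F N) (k : ℕ) (hs : ((𝔇.w1 F θ).li.analytic θ.γ).Signs) :
    N22At (u3OfRecord₁₂ θ ((𝔇.w1 F θ).u3Objects θ.γ) k) ↔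
      ∀ g ∈ Window θ.γ, ∀ g' ∈ Window θ.γ, ∀ (U : ((𝔇.w1 F θ).pairing k).BgA) (X : Node00.W1.Dom (F.P k) θ.τ9.M),
        |(functionalC ((𝔇.w1 F θ).S k) g (((𝔇.w1 F θ).pairing k).embA U) X).re -
            (functionalC ((𝔇.w1 F θ).S k) g' (((𝔇.w1 F θ).pairing k).embA U) X).re| ≤
          Real.exp (-(((𝔇.w1 F θ).li.analytic θ.γ).κ * (domSys (F.P k) θ.τ9.M X.1).dj X.2)) *
            ∑ i ∈ Finset.range X.1, ((𝔇.w1 F θ).li.analytic θ.γ).moduli X.1 i * |g i - g' i| :=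
  (n22At_u3OfRecord₁₂_iff θ _ k hs).trans (((𝔇.w1 F θ).ne9_u3Objects_iff θ.γ k (Window θ.γ) _ _))

/-- **WHAT THE STUB SAYS AT THE NAMED READING** (§1's two faces): under the blocks' signs at every canonical parameter, `S_N22 (RRec₁₂ 𝔯_W1)` IS the history-Lipschitz
inequality above at every Stage-12 datum key and run length. [folklore] -/
theorem s_N22_rRec₁₂_w1_iff_ne9 (hs : ∀ (F : T4Family) (D : Datum F N) (h : IsDatumOfRecord₁₂C F N D), ((𝔇.w1 F h.params).li.analytic h.params.γ).Signs) :
    S_N22 (RRec₁₂ (RateReading₁₂.ofAssignment (assignment₁₂ 𝔇) ne1)) ↔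
      ∀ (F : T4Family) (D : Datum F N) (h : IsDatumOfRecord₁₂C F N D) (k : ℕ),
        ∀ g ∈ Window h.params.γ, ∀ g' ∈ Window h.params.γ,
          ∀ (U : ((𝔇.w1 F h.params).pairing k).BgA) (X : Node00.W1.Dom (F.P k) h.params.τ9.M),
            |(functionalC ((𝔇.w1 F h.params).S k) g (((𝔇.w1 F h.params).pairing k).embA U) X).re -
                (functionalC ((𝔇.w1 F h.params).S k) g' (((𝔇.w1 F h.params).pairing k).embA U) X).re| ≤
              Real.exp (-(((𝔇.w1 F h.params).li.analytic h.params.γ).κ * (domSys (F.P k) h.params.τ9.M X.1).dj X.2)) *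
                ∑ i ∈ Finset.range X.1, ((𝔇.w1 F h.params).li.analytic h.params.γ).moduli X.1 i * |g i - g' i| := by
  rw [s_N22_rRec₁₂_w1_iff]
  refine forall_congr' fun F => forall_congr' fun D => forall_congr' fun h => forall_congr' fun k => ?_
  exact n22At_w1_iff_ne9 𝔇 h.params k (hs F D h)

/-! ## §2 ROAD 3 at the named reading: (O) + (A) on 𝔇's towers ⟹ the stub ((P) free, letter equations `rfl`) -/

/-- **ROAD 3 AT THE NAMED W1 READING.**  If at every admissible Stage-12 tuple with provisos and every run length `k`, W1's level-`k` objects `u := (𝔇.w1 F θ).u3Objects θ.γ`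
carry (O) — oscillation fading `|u.EA k g U X − u.EA k g′ U X| ≤ li.C₀·u.θ₅^{scale X − a}·e^{−κ d X}` for window histories agreeing from `a ≤ scale X` on — and (A) — per young
coupling `i < scale X` a complex-differentiable extension of the section on a set containing the CLOSED `li.r`-discs about `]0, θ.γ]` with sup letter
`li.A·li.μ^{scale X − 1 − i}·e^{−κ d X}` —, and the inputs' numerals `0 < li.C₀`, `0 < li.θ₅`, `0 < li.A`, `li.θ₅ ≤ li.μ`, `li.C₀ ≤ 2·li.A`, `0 < li.r`, `0 < li.s < 1`
hold, then `S_N22 (RRec₁₂ 𝔯_W1)` — ONE application of module 2's `s_N22_rRec₁₂_of_oscAnalytic` with (P) := W1's `prefixDependenceOn_assignment₁₂_EA` and the letter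
equations `assignment₁₂_ω ∕ assignment₁₂_C₉` (`rfl`). [folklore] -/
theorem s_N22_rRec₁₂_w1_of_oscAnalytic
    (hnum : ∀ (F : T4Family) (θ : Stage12Params F N), θ.Provisos₁₂ F N → θ.Admissible F N →
      0 < (𝔇.w1 F θ).li.C₀ ∧ 0 < (𝔇.w1 F θ).li.θ₅ ∧ 0 < (𝔇.w1 F θ).li.A ∧ (𝔇.w1 F θ).li.θ₅ ≤ (𝔇.w1 F θ).li.μ ∧
        (𝔇.w1 F θ).li.C₀ ≤ 2 * (𝔇.w1 F θ).li.A ∧ 0 < (𝔇.w1 F θ).li.r ∧ 0 < (𝔇.w1 F θ).li.s ∧ (𝔇.w1 F θ).li.s < 1)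
    (hO : ∀ (F : T4Family) (θ : Stage12Params F N), θ.Provisos₁₂ F N → θ.Admissible F N → ∀ (k : ℕ),
      ∀ g ∈ Window θ.γ, ∀ g' ∈ Window θ.γ, ∀ (U : (((𝔇.w1 F θ).u3Objects θ.γ).levelCarriers k).BgA)
        (X : (((𝔇.w1 F θ).u3Objects θ.γ).levelCarriers k).Dom) (a : ℕ), a ≤ (((𝔇.w1 F θ).u3Objects θ.γ).levelCarriers k).scale X →
        (∀ n, a ≤ n → g n = g' n) →
          |((𝔇.w1 F θ).u3Objects θ.γ).EA k g U X - ((𝔇.w1 F θ).u3Objects θ.γ).EA k g' U X| ≤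
            (𝔇.w1 F θ).li.C₀ * ((𝔇.w1 F θ).u3Objects θ.γ).θ₅ ^ ((((𝔇.w1 F θ).u3Objects θ.γ).levelCarriers k).scale X - a) *
              Real.exp (-(((𝔇.w1 F θ).u3Objects θ.γ).κ * (((𝔇.w1 F θ).u3Objects θ.γ).levelCarriers k).d X)))
    (hA : ∀ (F : T4Family) (θ : Stage12Params F N), θ.Provisos₁₂ F N → θ.Admissible F N → ∀ (k : ℕ),
      ∀ g ∈ Window θ.γ, ∀ (U : (((𝔇.w1 F θ).u3Objects θ.γ).levelCarriers k).BgA) (X : (((𝔇.w1 F θ).u3Objects θ.γ).levelCarriers k).Dom) (i : ℕ),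
        i < (((𝔇.w1 F θ).u3Objects θ.γ).levelCarriers k).scale X → ∃ (Fz : ℂ → ℂ) (Dset : Set ℂ), DifferentiableOn ℂ Fz Dset ∧
          (∀ z ∈ Dset, ‖Fz z‖ ≤ (𝔇.w1 F θ).li.A * (𝔇.w1 F θ).li.μ ^ ((((𝔇.w1 F θ).u3Objects θ.γ).levelCarriers k).scale X - 1 - i) *
            Real.exp (-(((𝔇.w1 F θ).u3Objects θ.γ).κ * (((𝔇.w1 F θ).u3Objects θ.γ).levelCarriers k).d X))) ∧
          (∀ t ∈ Ioc (0 : ℝ) θ.γ, closedBall (t : ℂ) (𝔇.w1 F θ).li.r ⊆ Dset) ∧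
          (∀ t ∈ Ioc (0 : ℝ) θ.γ, Fz t = (((𝔇.w1 F θ).u3Objects θ.γ).EA k (Function.update g i t) U X : ℂ))) :
    S_N22 (RRec₁₂ (RateReading₁₂.ofAssignment (assignment₁₂ 𝔇) ne1)) := by
  refine s_N22_rRec₁₂_of_oscAnalytic _ fun F θ hP hθ g₀ os k => ?_
  obtain ⟨hC₀, hθ₅, hA0, hθμ, hCA, hr, hs0, hs1⟩ := hnum F θ hP hθ
  exact ⟨(𝔇.w1 F θ).li.C₀, (𝔇.w1 F θ).li.A, (𝔇.w1 F θ).li.μ, (𝔇.w1 F θ).li.r, (𝔇.w1 F θ).li.s,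
    Node00.W1.prefixDependenceOn_assignment₁₂_EA 𝔇 F θ g₀ os k (Window θ.γ), hO F θ hP hθ k, hA F θ hP hθ k, hC₀, hθ₅, hA0, hθμ, hCA, hr, hs0, hs1,
    Node00.W1.assignment₁₂_ω 𝔇 F θ g₀ os, Node00.W1.assignment₁₂_C₉ 𝔇 F θ g₀ os⟩

/-! ## §3 The slot-free road at the named reading: NE9 of the level functionals in any fading table -/

/-- **`S_N22 (RRec₁₂ 𝔯_W1)` FROM NE9 IN A FADING TABLE** («`FadingMemory` by name from a modulus» at the named reading): at every admissible Stage-12 tuple with provisos and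
run length `k`, the analytic block's signs and NE9 of the level functional `((𝔇.w1 F θ).u3Objects θ.γ).EA k` on `]0, θ.γ]` with decay `li.κ` in SOME table `Λ` fading —
`FadingMemory C₉ ω Λ` with `ω` the block's rate and `C₉ ≤` the block's amplitude — give the stub (module 3's `s_N22_rRec₁₂_of_ne9_fading`). [folklore] -/
theorem s_N22_rRec₁₂_w1_of_ne9_fading
    (h9 : ∀ (F : T4Family) (θ : Stage12Params F N), θ.Provisos₁₂ F N → θ.Admissible F N → ∀ (k : ℕ),
      ((𝔇.w1 F θ).li.analytic θ.γ).Signs ∧ ∃ (Λ : ℕ → ℕ → ℝ) (C₉ : ℝ),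
        NE9 (((𝔇.w1 F θ).u3Objects θ.γ).EA k) (Window θ.γ) (𝔇.w1 F θ).li.κ Λ ∧
          FadingMemory C₉ ((𝔇.w1 F θ).li.analytic θ.γ).ω Λ ∧ C₉ ≤ ((𝔇.w1 F θ).li.analytic θ.γ).C₉) :
    S_N22 (RRec₁₂ (RateReading₁₂.ofAssignment (assignment₁₂ 𝔇) ne1)) :=
  s_N22_rRec₁₂_of_ne9_fading _ fun F θ hP hθ _ _ k => h9 F θ hP hθ k

/-! ## §4 Honesty in the kernel: vanishing towers close the stub -/

/-- **INHABITATION IS NOT CONTENT, AT NODE N22's STUB**: if every level functional of `𝔇`'s reading VANISHES identically (as for W1's termless towers,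
`W1.exists_assignmentInputs₁₂_populated_functionals_zero`) and the analytic blocks carry their signs at the admissible tuples, then `S_N22 (RRec₁₂ 𝔯_W1)` holds with NO estimate
(NE9 of the zero functional in the block's own moduli, nonnegative under the signs).  A discharge keyed to `𝔯_W1` therefore NAMES its `𝔇` and owes the identification of
`𝔇`'s towers with the construction's (2.14) terms. [folklore] -/
theorem s_N22_rRec₁₂_w1_of_EA_zero
    (hs : ∀ (F : T4Family) (θ : Stage12Params F N), θ.Provisos₁₂ F N → θ.Admissible F N → ((𝔇.w1 F θ).li.analytic θ.γ).Signs)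
    (h0 : ∀ (F : T4Family) (θ : Stage12Params F N), θ.Provisos₁₂ F N → θ.Admissible F N → ∀ (k : ℕ) (g : ℕ → ℝ)
      (U : (((𝔇.w1 F θ).u3Objects θ.γ).levelCarriers k).BgA) (X : (((𝔇.w1 F θ).u3Objects θ.γ).levelCarriers k).Dom),
      ((𝔇.w1 F θ).u3Objects θ.γ).EA k g U X = 0) :
    S_N22 (RRec₁₂ (RateReading₁₂.ofAssignment (assignment₁₂ 𝔇) ne1)) := by
  refine s_N22_rRec₁₂_of_forall_admissible _ fun F θ hP hθ g₀ os k => ?_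
  refine n22At_u3OfRecord₁₂_of_ne9_le θ _ k (hs F θ hP hθ) (Λ := fun n i => ((𝔇.w1 F θ).u3Objects θ.γ).C₉ * ((𝔇.w1 F θ).u3Objects θ.γ).ω ^ (n - i))
    ?_ fun n i _ => le_rfl
  intro g _ g' _ U X
  rw [show ((RateReading₁₂.ofAssignment (assignment₁₂ 𝔇) ne1).lit F θ hP g₀ os).u3.EA k g U X = 0 from h0 F θ hP hθ k g U X,
    show ((RateReading₁₂.ofAssignment (assignment₁₂ 𝔇) ne1).lit F θ hP g₀ os).u3.EA k g' U X = 0 from h0 F θ hP hθ k g' U X,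
    sub_zero, abs_zero]
  exact mul_nonneg (Real.exp_nonneg _) (Finset.sum_nonneg fun i _ =>
    mul_nonneg (mul_nonneg (hs F θ hP hθ).C₉_nonneg (pow_nonneg (hs F θ hP hθ).ω_nonneg _)) (abs_nonneg _))

end YMDAG.N22

end
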